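import Literature.MathematicalPhysics.QuantumFieldTheory.Balaban1983to89.B9Thm34TowerVacuumLadder

/-!
# `Balaban1983to89.B9Eq365TowerGpSquaredLadder` — T. Bałaban, *Propagators for lattice gauge theories in a background field*, Commun. Math. Phys. **99** (1985) 389–434
# [Balaban1985BackgroundPropagators] (3.65) p. 403 («Q′(U′U)G′²(U′U)Q′*(U′U) = Q′(U)G′²(U)Q′*(U) + … », the `G′²`-terms of `C′(A)`), Thm 3.4 p. 400, Thm 3.1 (3.42) p. 397, with
# [Balaban1984PropagatorsII] (2.52)–(2.55) p. 232 and (2.66) p. 234: **THE TWO-BACKGROUND LADDER FOR THE SQUARE `G′_k(U)²` OF THE NE9 CHAIN's `k`-LEVEL SITE PROPAGATOR,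
# LATTICE-UNIFORMLY** — `conj b (readA φ G′_k(U)²) − conj b (readA φ G′_k(1)²) ≺ K_J·α·e^{−δ d}` over `towerGeom` with `α_J, K_J, δ` BEFORE `n, η, m, U`: the first brick of the
# third-operator storey (J′-c) of the lineage memo `ROUTE-Jprime-LOCATED-g99.md` (`X(U) − X(1)`, `X = Q̃′G′²Q̃′†`, needs exactly this `G′²`-difference), from the ladder
# `B9Thm34TowerVacuumLadder.exists_hasMajorant_GpOfUk_sub_flat` (`D = G′(U) − G′(1) ≺ B_Jαe^{−δ_J d}`), the vacuum row `B9Eq342TowerFlatBaseMajorants.exists_hasMajorants_GpOfUk_one`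
# (`G′(1) ≺ B_G len² e^{−δ₀d}`, `len = L^{n+1}η = 1` on print's diagonal) and the algebra `E² − F² = D² + DF + FD`, each product by [4] (2.66) (`B6RandomWalk.majorant_G0_mul_265`)

statement-level skeleton of published theorems with citation tags; proofs where landed; nothing here is a claim about the Yang–Mills mass gap

CITATION HEADER (lean-in-tree rule).  Audit cell `pub-balaban`, sub-cell `t4`, BINDER row NE9; NE9 crux-team LEAF PROVER 01 (`b2b-balaban-t4-ne9-formalise-leaf-01`,
gen 99; bears_on: R4/N22).  Vocabulary BY NAME: pv08's `B6RandomWalk.HasMajorant` ∕ `hasMajorant_mono` ∕ `hasMajorant_add` ∕ `majorant_G0_mul_265` ∕ `c1_nonneg`, `B4Sect5Proof.weaken`,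
r06's `B9Eq352DivFormLetters.conj` ∕ `conj_mul`, this lineage's `B9Eq324PenaltyKernelForm.readA` ∕ `readA_comp`, `B9Eq341TowerBlockGeometry.towerGeom` ∕ `len_towerGeom` ∕ `htri_towerGeom` ∕
`h261_towerGeom` ∕ `hdnn_towerGeom`, `B9Eq357QprimeTowerKernelForm.blkK`, `B9Thm34TowerVacuumLadder.exists_hasMajorant_GpOfUk_sub_flat`, `B9Eq342TowerFlatBaseMajorants.exists_hasMajorants_GpOfUk_one`,
the chain's `B9Eq324DeltaPrimeATower.GpOfUk`.  Sources read through those files' verbatim quotations: [Balaban1985BackgroundPropagators] pp. 397, 400, 403; [Balaban1984PropagatorsII]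
pp. 232, 234.  [folklore] the ring identity `E² − F² = (E − F)² + (E − F)F + F(E − F)`; COMPOSITION BY NAME; NOTHING of print's proofs is reproduced beyond what the named files prove.

WHAT IS PROVED (sorry-free; proof lane — no `def`).
* **`exists_hasMajorant_GpOfUk_sq_sub_flat`** — `∃ α_J > 0, K_J ≥ 0, δ > 0` BEFORE the lattice: on print's small-field class of the ladder file (U1, `‖U(b) − 1‖ ≤ αη`, the all-direction
  window `‖U_μ(x+e_ν) − U_μ(x)‖ ≤ αη²`, levels `‖Ū^j(b) − 1‖ ≤ ε_j ≤ αr^j`, `ε_j ≤ 1`, `Ū^j ∈ U1`, `α ≤ α_J`), ANY positivity witnesses, ANY `M, R_r, H`: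
  `HasMajorant (toB6 (towerGeom …) R_r H) (fun p => blkK p.1) (conj b (readA φ (G′_k(U) ∘ G′_k(U))) − conj b (readA φ (G′_k(1) ∘ G′_k(1)))) (fun a a′ => K_J·α·e^{−δ·d(a,a′)})`.
HONEST SCOPE.  Bookkeeping on top of the ladder and the vacuum row; constants crude (NOT print's); the Thm-3.1 inputs behind the ladder are the cell's MODEL rows («NE9 ⇐ the named
binders»; O-NE9-1, #5 UNRULED); NOT the third operator `(Q̃′G′²Q̃′†)⁻¹` itself, NOT `R_k`, NOT the bond `G_k`; NE9 NOT PRINTED ∕ NOT PROVED; spine PROVED 0∕9; rung (B)+1 finite T⁴ — NOT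
infinite volume, NOT mass gap, NOT BetaPertH, NOT Clay.  HONEST DEPENDENCY: continuum YM on T⁴ ⇐ BetaPertH ∧ nine spine estimates (0/9 proved); BetaPertH ⇐ (D1) ∧ (D4) ∧ CAP+tail;
G-an2-4 gates asym, D1 and NE2/3/4.  NEW file; nothing modified.  Net new unproved facts: 0.
-/

noncomputable section

open scoped BigOperators InnerProductSpace

namespace Literature.MathematicalPhysics.QuantumFieldTheory.Balaban1983to89.B9Eq365TowerGpSquaredLadder

open B4Sect5Torus (TSite)
open B7Prop1Explicit (U1)
open B9SectCLatticeCarrier (Bond shift)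
open B9Eq311L2Pairing (WL2)
open B11Eq103H1Complex (SiteL2K)
open B9Eq315QTower (towerP UlevOf)
open B9Eq324DeltaPrimeATower (laplacePrimeAk GpOfUk)
open B6RandomWalk (HasMajorant hasMajorant_mono hasMajorant_add majorant_G0_mul_265 c1_nonneg)
open B4Sect5Proof (weaken)
open B9Thm34Ext (toB6)
open B9Eq352DivFormLetters (conj)
open B9Eq324PenaltyKernelForm (readA readA_comp)
open B9Eq357QprimeTowerKernelForm (blkK)
open B9Eq341TowerBlockGeometry (towerGeom len_towerGeom htri_towerGeom h261_towerGeom hdnn_towerGeom)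
open B9Eq342TowerFlatBaseMajorants (exists_hasMajorants_GpOfUk_one)
open B9Thm34TowerVacuumLadder (exists_hasMajorant_GpOfUk_sub_flat)

section Main

variable {d : ℕ} (L : ℕ) [NeZero L] {𝔸 : Type*} [NormedRing 𝔸] [NormedAlgebra ℂ 𝔸] [CompleteSpace 𝔸] [NormOneClass 𝔸] [StarRing 𝔸] [FiniteDimensional ℂ 𝔸]
  {W : Type*} [NormedAddCommGroup W] [InnerProductSpace ℂ W] [FiniteDimensional ℂ W] (φ : W ≃ₗ[ℂ] 𝔸) {a' Mφ Mφ' : ℝ}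
  (hMφ : 0 ≤ Mφ) (hMφ' : 0 ≤ Mφ') (hφn : ∀ w, ‖φ w‖ ≤ Mφ * ‖w‖) (hφn' : ∀ X, ‖φ.symm X‖ ≤ Mφ' * ‖X‖) (ha' : 0 < a')
  {r : ℝ} (hr0 : 0 ≤ r) (hr1 : r < 1)
  (τ : 𝔸 →ₗ[ℂ] ℂ) (hτ₂ : ∀ X Y : 𝔸, τ (X * Y) = τ (Y * X)) (hφτ : ∀ X Y : 𝔸, ⟪φ.symm X, φ.symm Y⟫_ℂ = τ (star X * Y))
  {ι : Type} [Fintype ι] [DecidableEq ι] (b : Module.Basis ι ℝ 𝔸) {M₂ : ℝ} (hM₂ : 0 ≤ M₂) (hrepr : ∀ (v : 𝔸) (i : ι), |b.repr v i| ≤ M₂ * ‖v‖)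

include hMφ hMφ' hφn hφn' ha' hr0 hr1 hτ₂ hφτ hM₂ hrepr in
/-- **THE TWO-BACKGROUND LADDER FOR `G′_k²`, LATTICE-UNIFORMLY**: `conj b (readA φ G′_k(U)²) − conj b (readA φ G′_k(1)²) ≺ K_J·α·e^{−δ d}` over `towerGeom` for every background of print's
small-field class, `α ≤ α_J`, the constants chosen BEFORE `n, η, m, U` — by `E² − F² = (E−F)² + (E−F)F + F(E−F)` with `E − F ≺ B_Jαe^{−δ_J d}` (the ladder) and `F = G′_k(1) ≺ B_G e^{−δ₀ d}`
(the vacuum row on the diagonal `len = 1`), each product by (2.66).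
[cite: Balaban1985BackgroundPropagators, (3.65) p.403, Thm 3.4 p.400, Thm 3.1 (3.42) p.397; Balaban1984PropagatorsII, (2.52)–(2.55) p.232, (2.66) p.234] -/
theorem exists_hasMajorant_GpOfUk_sq_sub_flat (hd : 1 ≤ d) (hL3 : 3 ≤ L) :
    ∃ αJ KJ δJ : ℝ, 0 < αJ ∧ 0 ≤ KJ ∧ 0 < δJ ∧
      ∀ (n : ℕ) (η : ℝ), η * (L : ℝ) ^ (n + 1) = 1 →
      ∀ (c₀ c₁ : ℝ) [Fact (0 < c₀)] [Fact (0 < c₁)], c₀ * ((L : ℝ) ^ (n + 1)) ^ d = c₁ →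
      ∀ (m : Fin d → ℕ) [∀ i, NeZero (m i)] (U : Bond d (towerP L m (n + 1)) → 𝔸ˣ) (α : ℝ), 0 ≤ α → α ≤ αJ →
        (∀ bd, U bd ∈ U1 𝔸) → (∀ bd, ‖(U bd : 𝔸) - 1‖ ≤ α * η) →
        (∀ (x : TSite d (towerP L m (n + 1))) (μ ν : Fin d), ‖(U (shift ν x, μ) : 𝔸) - (U (x, μ) : 𝔸)‖ ≤ α * η ^ 2) →
      ∀ (εU : ℕ → ℝ), (∀ j, 0 ≤ εU j) → (∀ j, εU j ≤ 1) → (∀ j < n + 1, εU j ≤ α * r ^ j) →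
        (∀ (j : ℕ) (bd : Bond d (towerP L m (j + 1))), ‖(UlevOf L m (n + 1) U j bd : 𝔸) - 1‖ ≤ εU j) →
        (∀ (j : ℕ) (bd : Bond d (towerP L m (j + 1))), UlevOf L m (n + 1) U j bd ∈ U1 𝔸) →
      ∀ (hposU : ∀ x : SiteL2K ℂ d (towerP L m (n + 1)) c₀ W, x ≠ 0 → 0 < RCLike.re ⟪x, laplacePrimeAk L m n φ η U a' (c₁ := c₁) x⟫_ℂ)
        (hpos₁ : ∀ x : SiteL2K ℂ d (towerP L m (n + 1)) c₀ W, x ≠ 0 →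
          0 < RCLike.re ⟪x, laplacePrimeAk L m n φ η (fun _ : Bond d (towerP L m (n + 1)) => (1 : 𝔸ˣ)) a' (c₁ := c₁) x⟫_ℂ)
        (M Rr : ℝ) (H : Prop),
      HasMajorant (g := toB6 (towerGeom L m n η M) Rr H) (fun p : TSite d (towerP L m (n + 1)) × ι => blkK L m n p.1)
        (conj b (readA φ (GpOfUk L m n φ η U a' (c₁ := c₁) hposU ∘ₗ GpOfUk L m n φ η U a' (c₁ := c₁) hposU)) -
          conj b (readA φ (GpOfUk L m n φ η (fun _ : Bond d (towerP L m (n + 1)) => (1 : 𝔸ˣ)) a' (c₁ := c₁) hpos₁ ∘ₗ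
            GpOfUk L m n φ η (fun _ : Bond d (towerP L m (n + 1)) => (1 : 𝔸ˣ)) a' (c₁ := c₁) hpos₁)))
        (fun a a' => KJ * α * Real.exp (-(δJ * (towerGeom L m n η M).dist a a'))) := by
  obtain ⟨αJ, BJ, δJ, hαJ, hBJ, hδJ, Hlad⟩ :=
    exists_hasMajorant_GpOfUk_sub_flat L φ hMφ hMφ' hφn hφn' ha' hr0 hr1 τ hτ₂ hφτ b hM₂ hrepr hd hL3
  obtain ⟨BG, δ₀, hBG, hδ₀, hbase⟩ := exists_hasMajorants_GpOfUk_one L φ (a' := a') hMφ hMφ' hφn hφn' ha' τ hτ₂ hφτ b hM₂ hrepr hd hL3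
  -- the common rate `δ_s = min(δ_J, δ₀)`, halved by the (2.66) products
  have hδs0 : 0 < min δJ δ₀ := lt_min hδJ hδ₀
  have hc1 : 0 ≤ B6.c1 d (min δJ δ₀) (1 / 2) := c1_nonneg d _ _
  refine ⟨αJ, (BJ * αJ + 2 * BG) * BJ * B6.c1 d (min δJ δ₀) (1 / 2), min δJ δ₀ / 2, hαJ, by positivity, by positivity, ?_⟩
  intro n η hη c₀ c₁ _ _ hc m _ U α hα0 hαle hU1 hUs hUw εU hε0 hε1 hεr hlev hlev1 hposU hpos₁ M Rr H
  have hD := Hlad n η hη c₀ c₁ hc m U α hα0 hαle hU1 hUs hUw εU hε0 hε1 hεr hlev hlev1 hposU hpos₁ M Rr H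
  have hF := (hbase n η hη c₀ c₁ hc m hpos₁ M Rr H).1
  have hlen1 : ∀ a : (towerGeom L m n η M).Site, (towerGeom L m n η M).len a = 1 := fun a => by
    rw [len_towerGeom, mul_comm]; exact hη
  have hdnn := hdnn_towerGeom L m n η M
  -- the algebra `E² − F² = (E − F)² + ((E − F)F + F(E − F))`
  rw [readA_comp, readA_comp, B9Eq352DivFormLetters.conj_mul, B9Eq352DivFormLetters.conj_mul]
  generalize conj b (readA φ (GpOfUk L m n φ η U a' (c₁ := c₁) hposU)) = E at hD ⊢
  generalize conj b (readA φ (GpOfUk L m n φ η (fun _ : Bond d (towerP L m (n + 1)) => (1 : 𝔸ˣ)) a' (c₁ := c₁) hpos₁)) = F at hD hF ⊢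
  have hsplit : E * E - F * F = (E - F) * (E - F) + ((E - F) * F + F * (E - F)) := by
    simp only [mul_sub, sub_mul]; abel
  rw [hsplit]
  -- the two factors at the common rates `δ_s` and `δ_s/2`
  have hD1 : HasMajorant (g := toB6 (towerGeom L m n η M) Rr H) (fun p : TSite d (towerP L m (n + 1)) × ι => blkK L m n p.1) (E - F)
      (fun a a'' => BJ * α * Real.exp (-(min δJ δ₀ * (towerGeom L m n η M).dist a a''))) :=
    hasMajorant_mono _ hD fun a a'' => weaken (mul_nonneg hBJ hα0) le_rfl (min_le_left _ _) (hdnn a a'')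
  have hD2 : HasMajorant (g := toB6 (towerGeom L m n η M) Rr H) (fun p : TSite d (towerP L m (n + 1)) × ι => blkK L m n p.1) (E - F)
      (fun a a'' => BJ * α * Real.exp (-((1 - 1 / 2) * min δJ δ₀ * (towerGeom L m n η M).dist a a''))) :=
    hasMajorant_mono _ hD fun a a'' => weaken (mul_nonneg hBJ hα0) le_rfl (by linarith [min_le_left δJ δ₀, hδs0.le]) (hdnn a a'')
  have hF1 : HasMajorant (g := toB6 (towerGeom L m n η M) Rr H) (fun p : TSite d (towerP L m (n + 1)) × ι => blkK L m n p.1) F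
      (fun a a'' => BG * (1 : ℝ) * Real.exp (-(min δJ δ₀ * (towerGeom L m n η M).dist a a''))) :=
    hasMajorant_mono _ hF fun a a'' => by
      rw [hlen1 a, one_pow]
      exact weaken (by positivity) le_rfl (min_le_right _ _) (hdnn a a'')
  have hF2 : HasMajorant (g := toB6 (towerGeom L m n η M) Rr H) (fun p : TSite d (towerP L m (n + 1)) × ι => blkK L m n p.1) F
      (fun a a'' => BG * Real.exp (-((1 - 1 / 2) * min δJ δ₀ * (towerGeom L m n η M).dist a a''))) :=
    hasMajorant_mono _ hF fun a a'' => by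
      rw [hlen1 a, one_pow, mul_one]
      exact weaken hBG.le le_rfl (by linarith [min_le_right δJ δ₀, hδs0.le]) (hdnn a a'')
  have htri := htri_towerGeom L m n η M Rr H
  have h261 := h261_towerGeom L m n η M Rr H (by norm_num : (0 : ℝ) < 1 / 2) hδs0
  have hαδ : 0 ≤ (1 - 1 / 2) * min δJ δ₀ := by linarith [hδs0.le]
  -- the three products by (2.66)
  have hP1 := majorant_G0_mul_265 (g := toB6 (towerGeom L m n η M) Rr H) (fun p : TSite d (towerP L m (n + 1)) × ι => blkK L m n p.1) d (min δJ δ₀) (1 / 2)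
    BJ (BJ * α) (fun _ => α) hBJ (fun _ => hα0) (mul_nonneg hBJ hα0) hαδ htri h261 hD1 hD2
  have hP2 := majorant_G0_mul_265 (g := toB6 (towerGeom L m n η M) Rr H) (fun p : TSite d (towerP L m (n + 1)) × ι => blkK L m n p.1) d (min δJ δ₀) (1 / 2)
    BJ BG (fun _ => α) hBJ (fun _ => hα0) hBG.le hαδ htri h261 hD1 hF2
  have hP3 := majorant_G0_mul_265 (g := toB6 (towerGeom L m n η M) Rr H) (fun p : TSite d (towerP L m (n + 1)) × ι => blkK L m n p.1) d (min δJ δ₀) (1 / 2)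
    BG (BJ * α) (fun _ => (1 : ℝ)) hBG.le (fun _ => zero_le_one) (mul_nonneg hBJ hα0) hαδ htri h261 hF1 hD2
  refine hasMajorant_mono _ (hasMajorant_add _ hP1 (hasMajorant_add _ hP2 hP3)) fun a a'' => ?_
  have he : 0 ≤ Real.exp (-((1 - 1 / 2) * min δJ δ₀ * (toB6 (towerGeom L m n η M) Rr H).dist a a'')) := Real.exp_nonneg _
  have key : 0 ≤ BJ * B6.c1 d (min δJ δ₀) (1 / 2) * α * BJ *
      Real.exp (-((1 - 1 / 2) * min δJ δ₀ * (toB6 (towerGeom L m n η M) Rr H).dist a a'')) * (αJ - α) :=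
    mul_nonneg (by positivity) (sub_nonneg.mpr hαle)
  have final : BJ * B6.c1 d (min δJ δ₀) (1 / 2) * α * (BJ * α) * Real.exp (-((1 - 1 / 2) * min δJ δ₀ * (toB6 (towerGeom L m n η M) Rr H).dist a a'')) +
      (BJ * B6.c1 d (min δJ δ₀) (1 / 2) * α * BG * Real.exp (-((1 - 1 / 2) * min δJ δ₀ * (toB6 (towerGeom L m n η M) Rr H).dist a a'')) +
        BG * B6.c1 d (min δJ δ₀) (1 / 2) * 1 * (BJ * α) * Real.exp (-((1 - 1 / 2) * min δJ δ₀ * (toB6 (towerGeom L m n η M) Rr H).dist a a''))) ≤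
      (BJ * αJ + 2 * BG) * BJ * B6.c1 d (min δJ δ₀) (1 / 2) * α *
        Real.exp (-((1 - 1 / 2) * min δJ δ₀ * (toB6 (towerGeom L m n η M) Rr H).dist a a'')) := by
    nlinarith [key, he]
  show _ ≤ (BJ * αJ + 2 * BG) * BJ * B6.c1 d (min δJ δ₀) (1 / 2) * α * Real.exp (-(min δJ δ₀ / 2 * (towerGeom L m n η M).dist a a''))
  rw [show min δJ δ₀ / 2 = (1 - 1 / 2) * min δJ δ₀ by ring]
  exact final

end Main

end Literature.MathematicalPhysics.QuantumFieldTheory.Balaban1983to89.B9Eq365TowerGpSquaredLadder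

end
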